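import Summits.BirchSwinnertonDyer.BirchSwinnertonDyer.Theorems.EisensteinPrimesGreenbergFullAtSelmer
import Literature.NumberTheory.IwasawaTheory.Greenberg2006.CoinducedModuleDual
import Mathlib.RepresentationTheory.Homological.ContCohomology.LowDegree
import Mathlib.LinearAlgebra.Dimension.Torsion.Finite
import Mathlib.LinearAlgebra.Dimension.Localization
import HarnessLib

/-!
# Route `EisensteinPrimes` (rung K5), crux 2 `GoodLatticeBDPValue`, line `halves` v5, stub
# `stub_noPseudoNull`, road (γ): corank ALGEBRA for the hypothesis CRK(`𝐃`, `𝓛_η`) of Greenberg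
# 2016 Prop. 4.1.1 — uniqueness, vanishing under a non-zero-divisor, products with a cotorsion
# factor, the readings `corank H⁰ = 0` / `corank H¹ = 1` / `corank H²(K_v) = 0` from the published
# Euler–Poincaré formulas, and CRK from three corank values (helper for stmt-BirchSwinnertonDyer-19032)

Cell `bsd-eis`, seat `bsd-eis-k5-c2` (gen 8), k5-c2 lane of planner RULING L55 (A) ("CRK corank
bookkeeping"); HOME/k5-c2-MEMO-8.md §3 (CRK). `Greenberg2016.Specification.CRK L` is typed as
"whatever the three coranks `h, s, q` of `H¹(K_Σ/K, 𝐃)`, `S_𝓛`, `Q_𝓛` are, `h = s + q`" with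
`HasCorank Λ S r := every Pontryagin dual has finrank r`. This file supplies the algebra that turns
that universally quantified clause into three corank VALUES and reads two of them off the PUBLISHED
corank formulas `Greenberg2006.prop41_globalEulerPoincareCorank` / `prop42_localEulerPoincareCorank`
and `sec5A_localH2_subsingleton_of_LOC1`:

* §1 `hasCorank_characterModule` (the canonical datum realises the corank), `hasCorank_unique`,
  `hasCorank_zero_of_forall_smul_eq_zero` / `isCotorsion_of_forall_smul_eq_zero` (a module killed by
  a non-zero scalar of the domain `Λ` has corank `0` and is cotorsion),
  `isCotorsion_of_isCofinitelyGenerated_of_hasCorank_zero`, and `hasCorank_prod_of_isCotorsion`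
  (`corank (S × S') = corank S` when `S'` is cotorsion — rank–nullity over a domain, Mathlib
  `rank_quotient_add_rank_of_isDomain`).
* §2 `hasCorank_H0_zero_of_exists_smul` — `corank H⁰(G, 𝐃) = 0` as soon as ONE `g ∈ G` acts on
  `𝐃` as a scalar `u ≠ 1` of the domain `Λ` (`H⁰ = 𝐃^G ⊆ 𝐃[u − 1]`, Mathlib
  `ContinuousCohomology.zeroIso`); for the twist deformation `u = tγ^{-κ(σ)}`
  (`localRep_twistDeformation_eq_smul`).
* §3 the readings: `hasCorank_H1_one_of_prop41` (`K` totally imaginary with one complex place,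
  `corank 𝐃 = 1`, `corank H⁰ = corank H² = 0` ⇒ `corank H¹(K_Σ/K, 𝐃) = 1`),
  `hasCorank_localH1_one_of_prop42` (degree-one `v ∣ p`), `hasCorank_localH1_zero_of_prop42`
  (`v ∤ p`), `hasCorank_localH2_zero_of_sec5A` (LOC_v⁽¹⁾ ⇒ `corank H²(K_v, 𝐃) = 0`).
* §4 `CRK_of_hasCorank`: CRK(`𝐃`, `𝓛`) from `corank H¹ = s₀ + q₀`, `corank S_𝓛 = s₀`,
  `corank Q_𝓛 = q₀`.

What it does NOT do (MEMO-8 §3): the additivity `corank Q_𝓛 = Σ_{v ∈ Σ} corank Q_𝓛(K_v, 𝐃)` over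
the finite product, which needs the COTORSION (indeed cofinite generation, [Gr4] Prop. 3.2 — not in
the tree) of the local factors; the inputs `corank S_𝓛 = 0` (K-Sh + BCGKPST §3.3) and
`corank H²(K_Σ/K, 𝐃) = 0` (LEO-grade). Theorems only; no named fact introduced, no `sorry`.
HONEST FRAMING: conditional on the PUBLISHED named facts it consumes as hypotheses; closes nothing
by itself (`--supports`). References: [Greenberg2016Selmer] §2.3 p. 7 (CRK); [Greenberg2006] §4 A
Props. 4.1, 4.2 pp. 367–368, §5 A p. 373.
-/

set_option autoImplicit false
set_option linter.dupNamespace false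

noncomputable section

open scoped Classical
open NumberField IsDedekindDomain Field
open Literature.NumberTheory.GaloisRepresentations Literature.NumberTheory.IwasawaTheory.Greenberg2016
  Literature.NumberTheory.IwasawaTheory.Greenberg2006

universe u

namespace Summit.BirchSwinnertonDyer.BirchSwinnertonDyer.Theorems.GreenbergFullAtSelmer

/-! ## §1 Corank algebra -/

section Algebra

variable {Λ : Type u} [CommRing Λ] {S : Type u} [AddCommGroup S] [Module Λ S]

/-- The canonical Pontryagin dual `Hom(S, ℚ/ℤ)` realises the corank: `HasCorank Λ S (finrank …)`.
[cite: Greenberg2016Selmer, §1 p. 2 L17–35 (Pontryagin duals), §2.3 p. 7 L5–13] -/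
theorem hasCorank_characterModule :
    HasCorank Λ S (Module.finrank Λ (CharacterModule S)) :=
  hasCorank_of_isDualPairing (isDualPairing_characterModule Λ S) rfl

/-- **Coranks are unique** (two corank witnesses agree on the canonical dual).
[cite: Greenberg2016Selmer, §2.3 p. 7 L5–13] -/
theorem hasCorank_unique {r r' : ℕ} (h : HasCorank Λ S r) (h' : HasCorank Λ S r') : r = r' :=
  (h _ _ (isDualPairing_characterModule Λ S)).symm.trans (h' _ _ (isDualPairing_characterModule Λ S))

/-- A dual of a module killed by the scalar `a` is killed by `a`. [cite: Greenberg2016Selmer, §1 p. 2 L17–35] -/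
theorem smul_eq_zero_of_isDualPairing {a : Λ} (hS : ∀ s : S, a • s = 0) {X : Type u} [AddCommGroup X]
    [Module Λ X] {C : Type*} [AddCommGroup C] {toDual : X →+ (S →+ C)} (hX : IsDualPairing Λ S toDual)
    (x : X) : a • x = 0 :=
  hX.injective (by ext s; rw [hX.map_smul, hS, map_zero, map_zero, AddMonoidHom.zero_apply])

/-- **A module killed by a non-zero scalar of the domain `Λ` has corank `0`.**
[cite: Greenberg2016Selmer, §2.3 p. 7 L5–13] -/
theorem hasCorank_zero_of_forall_smul_eq_zero [IsDomain Λ] {a : Λ} (ha : a ≠ 0)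
    (hS : ∀ s : S, a • s = 0) : HasCorank Λ S 0 := fun _ _ _ _ hX ↦
  Module.finrank_eq_zero_of_rank_eq_zero
    (rank_eq_zero_iff.mpr fun x ↦ ⟨a, ha, smul_eq_zero_of_isDualPairing hS hX x⟩)

/-- A module killed by a non-zero scalar of the domain `Λ` is cotorsion.
[cite: Greenberg2016Selmer, §1 p. 1 L30–32] -/
theorem isCotorsion_of_forall_smul_eq_zero [IsDomain Λ] {a : Λ} (ha : a ≠ 0)
    (hS : ∀ s : S, a • s = 0) : IsCotorsion Λ S := fun _ _ _ _ hX x ↦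
  ⟨⟨a, mem_nonZeroDivisors_of_ne_zero ha⟩, smul_eq_zero_of_isDualPairing hS hX x⟩

/-- **Cofinitely generated of corank `0` ⇒ cotorsion** (a finitely generated module over a domain
with `finrank = 0` is torsion). [cite: Greenberg2016Selmer, §2.3 p. 7 L5–13] [cite: Greenberg2006, §4 p. 367 L33–39] -/
theorem isCotorsion_of_isCofinitelyGenerated_of_hasCorank_zero [IsDomain Λ]
    (hfg : IsCofinitelyGenerated Λ S) (h0 : HasCorank Λ S 0) : IsCotorsion Λ S := fun X _ _ toDual hX ↦ by
  haveI : Module.Finite Λ X := hfg X toDual hX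
  exact (Module.finrank_eq_zero_iff_isTorsion (R := Λ) (M := X)).mp (h0 X toDual hX)

/-- The Pontryagin dual of a product is the product of the duals: from dual data of `S` and `S'`
(values in the same `C`) the dual datum `(x, x') ↦ toDual x ∘ pr₁ + toDual' x' ∘ pr₂` of `S × S'` on
`X × X'`. [cite: Greenberg2016Selmer, §1 p. 2 L17–35] -/
theorem isDualPairing_prod {S' : Type u} [AddCommGroup S'] [Module Λ S'] {C : Type*} [AddCommGroup C]
    {X X' : Type u} [AddCommGroup X] [Module Λ X] [AddCommGroup X'] [Module Λ X']
    {toDual : X →+ (S →+ C)} {toDual' : X' →+ (S' →+ C)} (hX : IsDualPairing Λ S toDual)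
    (hX' : IsDualPairing Λ S' toDual') :
    IsDualPairing Λ (S × S')
      (AddMonoidHom.mk' (fun xx' : X × X' ↦ (toDual xx'.1).coprod (toDual' xx'.2))
        (fun a b ↦ by
          ext s
          simp only [Prod.fst_add, Prod.snd_add, map_add, AddMonoidHom.coprod_apply,
            AddMonoidHom.add_apply]
          abel)) := by
  refine ⟨⟨?_, ?_⟩, ?_⟩
  · rintro ⟨x, x'⟩ ⟨y, y'⟩ hxy
    have h1 : ∀ s : S, toDual x s = toDual y s := fun s ↦ by
      simpa using congr_arg (fun φ : S × S' →+ C ↦ φ (s, 0)) hxy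
    have h2 : ∀ s' : S', toDual' x' s' = toDual' y' s' := fun s' ↦ by
      simpa using congr_arg (fun φ : S × S' →+ C ↦ φ (0, s')) hxy
    exact Prod.ext (hX.injective (AddMonoidHom.ext h1)) (hX'.injective (AddMonoidHom.ext h2))
  · intro g
    obtain ⟨x, hx⟩ := hX.bijective.2 (g.comp (AddMonoidHom.inl S S'))
    obtain ⟨x', hx'⟩ := hX'.bijective.2 (g.comp (AddMonoidHom.inr S S'))
    refine ⟨(x, x'), ?_⟩
    ext ⟨s, s'⟩
    simp only [AddMonoidHom.mk'_apply, AddMonoidHom.coprod_apply, hx, hx', AddMonoidHom.comp_apply,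
      AddMonoidHom.inl_apply, AddMonoidHom.inr_apply, ← map_add, Prod.mk_add_mk, add_zero, zero_add]
  · rintro r ⟨x, x'⟩ ⟨s, s'⟩
    simp only [AddMonoidHom.mk'_apply, Prod.smul_mk, AddMonoidHom.coprod_apply, hX.map_smul,
      hX'.map_smul]

/-- **`corank (S × S') = corank S` when `S'` is cotorsion** (`Λ` a domain): the dual of the product is
the product of the duals, and rank is additive with `rank (torsion) = 0` (rank–nullity over a domain,
Mathlib `rank_quotient_add_rank_of_isDomain`). [cite: Greenberg2016Selmer, §2.3 p. 7 L5–13] -/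
theorem hasCorank_prod_of_isCotorsion [IsDomain Λ] {S' : Type u} [AddCommGroup S'] [Module Λ S']
    {r : ℕ} (h : HasCorank Λ S r) (h' : IsCotorsion Λ S') : HasCorank Λ (S × S') r := by
  intro Y _ _ toDualY hY
  have hprod := isDualPairing_prod (isDualPairing_characterModule Λ S) (isDualPairing_characterModule Λ S')
  rw [← (hprod.linearEquiv hY).finrank_eq, ← h _ _ (isDualPairing_characterModule Λ S)]
  -- `rank (X × X') = rank X` since `X' = Hom(S', ℚ/ℤ)` is torsion
  have hX'0 : Module.rank Λ (CharacterModule S') = 0 :=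
    rank_eq_zero_iff_isTorsion.mpr (h' _ _ (isDualPairing_characterModule Λ S'))
  have key : Module.rank Λ (CharacterModule S × CharacterModule S') = Module.rank Λ (CharacterModule S) := by
    have h1 := rank_quotient_add_rank_of_isDomain
      (LinearMap.ker (LinearMap.fst Λ (CharacterModule S) (CharacterModule S')))
    rw [((LinearMap.fst Λ (CharacterModule S) (CharacterModule S')).quotKerEquivOfSurjective
      Prod.fst_surjective).rank_eq, LinearMap.ker_fst,
      ← (LinearEquiv.ofInjective _ LinearMap.inr_injective).rank_eq, hX'0, add_zero] at h1
    exact h1.symm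
  simp only [Module.finrank, key]

end Algebra

/-! ### §1b Finite products: `corank (Π_i S_i) = corank (S_{i₀})` when the other factors are cotorsion -/

section Pi

variable {Λ : Type u} [CommRing Λ] {ι : Type u} [Fintype ι] [DecidableEq ι]
  {S : ι → Type u} [∀ i, AddCommGroup (S i)] [∀ i, Module Λ (S i)]

/-- The Pontryagin dual of a finite product is the product of the duals: from dual data of the
`S i` (values in the same `C`) the dual datum `x ↦ ∑ᵢ toDualᵢ xᵢ ∘ prᵢ` of `Πᵢ S i` on `Πᵢ X i`.
[cite: Greenberg2016Selmer, §1 p. 2 L17–35] -/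
theorem isDualPairing_pi {C : Type*} [AddCommGroup C] {X : ι → Type u} [∀ i, AddCommGroup (X i)]
    [∀ i, Module Λ (X i)] {toDual : ∀ i, X i →+ (S i →+ C)} (hX : ∀ i, IsDualPairing Λ (S i) (toDual i)) :
    IsDualPairing Λ (∀ i, S i)
      (AddMonoidHom.mk' (fun x : ∀ i, X i ↦ ∑ i, (toDual i (x i)).comp (Pi.evalAddMonoidHom S i))
        (fun a b ↦ by
          ext s
          simp only [Pi.add_apply, map_add, AddMonoidHom.add_comp, Finset.sum_add_distrib])) := by
  refine ⟨⟨?_, ?_⟩, ?_⟩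
  · have key : ∀ (z : ∀ i, X i) (i : ι) (s : S i),
        (∑ j, (toDual j (z j)).comp (Pi.evalAddMonoidHom S j)) (Pi.single i s) = toDual i (z i) s :=
      fun z i s ↦ by
        rw [AddMonoidHom.finsetSum_apply, Finset.sum_eq_single i (fun j _ hj ↦ by
          rw [AddMonoidHom.comp_apply, Pi.evalAddMonoidHom_apply, Pi.single_eq_of_ne hj, map_zero])
          (fun hi ↦ absurd (Finset.mem_univ i) hi), AddMonoidHom.comp_apply, Pi.evalAddMonoidHom_apply,
          Pi.single_eq_same]
    intro x y hxy
    funext i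
    apply (hX i).injective
    ext s
    have := congr_arg (fun φ : (∀ i, S i) →+ C ↦ φ (Pi.single i s)) hxy
    simp only [AddMonoidHom.mk'_apply, key] at this
    exact this
  · intro g
    choose x hx using fun i ↦ (hX i).bijective.2 (g.comp (AddMonoidHom.single S i))
    refine ⟨x, ?_⟩
    ext s
    simp only [AddMonoidHom.mk'_apply, AddMonoidHom.finsetSum_apply, AddMonoidHom.comp_apply,
      Pi.evalAddMonoidHom_apply, hx, AddMonoidHom.single_apply]
    rw [← map_sum, Finset.univ_sum_single]
  · intro r x s
    simp only [AddMonoidHom.mk'_apply, AddMonoidHom.finsetSum_apply, AddMonoidHom.comp_apply,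
      Pi.evalAddMonoidHom_apply, Pi.smul_apply, (hX _).map_smul]

/-- A finite product of torsion modules is torsion. [folklore] -/
theorem isTorsion_pi {X : ι → Type u} [∀ i, AddCommGroup (X i)] [∀ i, Module Λ (X i)]
    (h : ∀ i, Module.IsTorsion Λ (X i)) : Module.IsTorsion Λ (∀ i, X i) := by
  intro x
  choose a ha using fun i ↦ @h i (x i)
  refine ⟨∏ i, a i, funext fun i ↦ ?_⟩
  have hai : ((a i : Λ)) • x i = 0 := by simpa only [Submonoid.smul_def] using ha i
  rw [Pi.smul_apply, Pi.zero_apply, Submonoid.smul_def, Submonoid.coe_finsetProd,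
    ← Finset.mul_prod_erase Finset.univ (fun j ↦ ((a j : Λ))) (Finset.mem_univ i), mul_comm, mul_smul,
    hai, smul_zero]

/-- **A finite product of cotorsion modules is cotorsion.** [cite: Greenberg2016Selmer, §1 p. 1 L30–32] -/
theorem isCotorsion_pi (h : ∀ i, IsCotorsion Λ (S i)) : IsCotorsion Λ (∀ i, S i) := by
  intro Y _ _ toDualY hY
  have hpi := isDualPairing_pi (fun i ↦ isDualPairing_characterModule Λ (S i))
  have hT : Module.IsTorsion Λ (∀ i, CharacterModule (S i)) :=
    isTorsion_pi fun i ↦ h i _ _ (isDualPairing_characterModule Λ (S i))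
  intro y
  obtain ⟨a, ha⟩ := @hT (hY.linearEquiv hpi y)
  refine ⟨a, (hY.linearEquiv hpi).injective ?_⟩
  rw [Submonoid.smul_def, map_smul, map_zero, ← Submonoid.smul_def, ha]

/-- **`corank (Πᵢ S i) = corank (S i₀)` when every other factor is cotorsion** (`Λ` a domain;
`Πᵢ S i ≃ₗ S i₀ × Π_{i ≠ i₀} S i`, Mathlib `Equiv.piSplitAt`). [cite: Greenberg2016Selmer, §2.3 p. 7 L5–13] -/
theorem hasCorank_pi_of_isCotorsion [IsDomain Λ] (i₀ : ι) {r : ℕ} (h₀ : HasCorank Λ (S i₀) r)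
    (h : ∀ i, i ≠ i₀ → IsCotorsion Λ (S i)) : HasCorank Λ (∀ i, S i) r :=
  let e : (∀ i, S i) ≃ₗ[Λ] S i₀ × ∀ i : {i // i ≠ i₀}, S i :=
    { Equiv.piSplitAt i₀ S with
      map_add' := fun _ _ ↦ rfl
      map_smul' := fun _ _ ↦ rfl }
  hasCorank_of_linearEquiv e.symm
    (hasCorank_prod_of_isCotorsion h₀ (isCotorsion_pi fun i : {i // i ≠ i₀} ↦ h i.1 i.2))

end Pi

/-! ## §2 `corank H⁰(G, 𝐃) = 0` when some element acts as a scalar `u ≠ 1` -/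

section H0

variable {Λ : Type u} [CommRing Λ] [IsDomain Λ] [TopologicalSpace Λ]
  {G : Type u} [Group G] [TopologicalSpace G] [IsTopologicalGroup G]
  {D : Type u} [AddCommGroup D] [Module Λ D] [TopologicalSpace D] [IsTopologicalAddGroup D]
  [ContinuousSMul Λ D]

/-- **`corank_Λ H⁰(G, 𝐃) = 0` as soon as ONE `g ∈ G` acts on `𝐃` as a scalar `u ≠ 1`** of the domain
`Λ`: `H⁰(G, 𝐃) = 𝐃^G` (Mathlib `ContinuousCohomology.zeroIso`) is killed by `u − 1 ≠ 0`. For the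
twist deformation, `σ` with `κ(σ) ≠ 0` acts as `u = tγ^{-κ(σ)} ≠ 1`
(`localRep_twistDeformation_eq_smul`, `C_mul_groupLike_mul_ne_C`). [cite: Greenberg2006, Prop. 4.1 / 4.2 (§4 A, pp. 367–368: the terms corank H⁰)] -/
theorem hasCorank_H0_zero_of_exists_smul (τ : ContinuousRep G Λ D) {g : G} {u : Λ} (hu : u ≠ 1)
    (hg : ∀ d : D, τ g d = u • d) : HasCorank Λ (τ.H 0) 0 := by
  have e : τ.H 0 ≃ₗ[Λ] τ.toTopRep.ρ.invariants :=
    (ContinuousCohomology.zeroIso τ.toTopRep).toContinuousLinearEquiv.toLinearEquiv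
  refine hasCorank_of_linearEquiv e.symm (hasCorank_zero_of_forall_smul_eq_zero (sub_ne_zero.mpr hu) ?_)
  rintro ⟨d, hd⟩
  apply Subtype.ext
  show (u - 1) • d = 0
  have hfix : τ g d = d := hd g
  rw [sub_smul, one_smul, ← hg, hfix, sub_self]

end H0

/-! ## §3 Reading the corank values off the published Euler–Poincaré formulas -/

section Readings

variable {p : ℕ} [Fact p.Prime] {K : Type} [Field K] [NumberField K]
  {S : Set (HeightOneSpectrum (𝓞 K))}
  {Λ : Type} [CommRing Λ] [TopologicalSpace Λ] [IsTopologicalRing Λ] {mΛ : ℕ}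
  {D : Type} [AddCommGroup D] [Module Λ D] [TopologicalSpace D] [DiscreteTopology D]
  [ContinuousSMul Λ D] (ρ : ContinuousRep (GaloisGroupUnramifiedOutside K S) Λ D)

/-- **`corank H¹(K_Σ/K, 𝐃) = 1`** for `K` totally imaginary with ONE complex place (imaginary
quadratic), `corank 𝐃 = 1`, `corank H⁰ = corank H² = 0` — Greenberg 2006 Prop. 4.1:
`h₀ − h₁ + h₂ = −r₂·m`. [cite: Greenberg2006, Prop. 4.1 (§4 A, p. 367 L40 – p. 368 L1)] -/
theorem hasCorank_H1_one_of_prop41 (h41 : prop41_globalEulerPoincareCorank) (hSf : S.Finite)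
    (hS : ∀ v : HeightOneSpectrum (𝓞 K), ((p : ℕ) : 𝓞 K) ∈ v.asIdeal → v ∈ S)
    (hK : ∀ w : InfinitePlace K, w.IsComplex) (hr₂ : InfinitePlace.nrComplexPlaces K = 1)
    (hΛ : Nonempty (Λ ≃+* MvPowerSeries (Fin mΛ) ℤ_[p]))
    (hp : ∀ d : D, ∃ n : ℕ, (p ^ n : ℤ) • d = 0) (hcf : IsCofinitelyGenerated Λ D)
    (hm : HasCorank Λ D 1) (h0 : HasCorank Λ (ρ.H 0) 0) (h2 : HasCorank Λ (ρ.H 2) 0) :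
    HasCorank Λ (ρ.H 1) 1 := by
  have hc : HasCorank Λ (ρ.H 1) (Module.finrank Λ (CharacterModule (ρ.H 1))) :=
    hasCorank_characterModule
  have key := h41 p K S hSf hS hK Λ mΛ hΛ D ρ hp hcf 1 0 (Module.finrank Λ (CharacterModule (ρ.H 1))) 0
    hm h0 hc h2
  rw [hr₂] at key
  have h1 : Module.finrank Λ (CharacterModule (ρ.H 1)) = 1 := by push_cast at key; omega
  exact hasCorank_of_isDualPairing (isDualPairing_characterModule Λ _) h1

/-- **`corank H¹(K_v, 𝐃) = corank 𝐃`** at a place `v ∣ p` of local degree one (e.g. split in an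
imaginary quadratic field), when `corank H⁰(K_v, 𝐃) = corank H²(K_v, 𝐃) = 0` — Greenberg 2006
Prop. 4.2 (a). [cite: Greenberg2006, Prop. 4.2 (a) (§4 A, p. 368 L9–22)] -/
theorem hasCorank_localH1_of_prop42_degree_one (h42 : prop42_localEulerPoincareCorank) (hSf : S.Finite)
    (hS : ∀ v : HeightOneSpectrum (𝓞 K), ((p : ℕ) : 𝓞 K) ∈ v.asIdeal → v ∈ S)
    (hΛ : Nonempty (Λ ≃+* MvPowerSeries (Fin mΛ) ℤ_[p]))
    (hp : ∀ d : D, ∃ n : ℕ, (p ^ n : ℤ) • d = 0) (hcf : IsCofinitelyGenerated Λ D)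
    {v : HeightOneSpectrum (𝓞 K)} (hv : ((p : ℕ) : 𝓞 K) ∈ v.asIdeal)
    (hdeg : v.asIdeal.ramificationIdx ℤ * v.asIdeal.inertiaDeg ℤ = 1) {m : ℕ} (hm : HasCorank Λ D m)
    (h0 : HasCorank Λ ((localRep S ρ (Sum.inr v)).H 0) 0)
    (h2 : HasCorank Λ ((localRep S ρ (Sum.inr v)).H 2) 0) :
    HasCorank Λ ((localRep S ρ (Sum.inr v)).H 1) m := by
  have hc : HasCorank Λ ((localRep S ρ (Sum.inr v)).H 1)
      (Module.finrank Λ (CharacterModule ((localRep S ρ (Sum.inr v)).H 1))) :=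
    hasCorank_characterModule
  have key := prop42_localEulerPoincareCorank.of_degree_one h42 hSf hS hΛ ρ hp hcf hv hdeg hm h0 hc h2
  have h1 : Module.finrank Λ (CharacterModule ((localRep S ρ (Sum.inr v)).H 1)) = m := by omega
  exact hasCorank_of_isDualPairing (isDualPairing_characterModule Λ _) h1

/-- **`corank H¹(K_v, 𝐃) = 0`** at a finite place `v ∤ p`, when `corank H⁰(K_v, 𝐃) = corank
H²(K_v, 𝐃) = 0` — Greenberg 2006 Prop. 4.2 (b). [cite: Greenberg2006, Prop. 4.2 (b) (§4 A, p. 368 L9–22)] -/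
theorem hasCorank_localH1_zero_of_prop42 (h42 : prop42_localEulerPoincareCorank) (hSf : S.Finite)
    (hS : ∀ v : HeightOneSpectrum (𝓞 K), ((p : ℕ) : 𝓞 K) ∈ v.asIdeal → v ∈ S)
    (hΛ : Nonempty (Λ ≃+* MvPowerSeries (Fin mΛ) ℤ_[p]))
    (hp : ∀ d : D, ∃ n : ℕ, (p ^ n : ℤ) • d = 0) (hcf : IsCofinitelyGenerated Λ D)
    {v : HeightOneSpectrum (𝓞 K)} (hv : ((p : ℕ) : 𝓞 K) ∉ v.asIdeal) {m : ℕ} (hm : HasCorank Λ D m)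
    (h0 : HasCorank Λ ((localRep S ρ (Sum.inr v)).H 0) 0)
    (h2 : HasCorank Λ ((localRep S ρ (Sum.inr v)).H 2) 0) :
    HasCorank Λ ((localRep S ρ (Sum.inr v)).H 1) 0 := by
  have hc : HasCorank Λ ((localRep S ρ (Sum.inr v)).H 1)
      (Module.finrank Λ (CharacterModule ((localRep S ρ (Sum.inr v)).H 1))) :=
    hasCorank_characterModule
  have key := (h42 p K S hSf hS Λ mΛ hΛ D ρ hp hcf v m 0 _ 0 hm h0 hc h2).2 hv
  have h1 : Module.finrank Λ (CharacterModule ((localRep S ρ (Sum.inr v)).H 1)) = 0 := by omega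
  exact hasCorank_of_isDualPairing (isDualPairing_characterModule Λ _) h1

/-- **`corank H²(K_v, 𝐃) = 0`** under LOC_v⁽¹⁾(`𝐃`) — [Gr4] §5 A (`H²(K_v, 𝐃)` is dual to
`(T*)^{G_{K_v}} = 0`). [cite: Greenberg2006, §5 A (p. 373)] -/
theorem hasCorank_localH2_zero_of_sec5A [Nontrivial Λ] (h5A : sec5A_localH2_subsingleton_of_LOC1)
    (hSf : S.Finite) (hS : ∀ v : HeightOneSpectrum (𝓞 K), ((p : ℕ) : 𝓞 K) ∈ v.asIdeal → v ∈ S)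
    (hΛ : Nonempty (Λ ≃+* MvPowerSeries (Fin mΛ) ℤ_[p]))
    (hp : ∀ d : D, ∃ n : ℕ, (p ^ n : ℤ) • d = 0) (hcf : IsCofinitelyGenerated Λ D)
    {v : HeightOneSpectrum (𝓞 K)} (hLOC1 : LOC1 S ρ (Sum.inr v)) :
    HasCorank Λ ((localRep S ρ (Sum.inr v)).H 2) 0 :=
  haveI := h5A p K S hSf hS Λ mΛ hΛ D ρ hp hcf v hLOC1
  hasCorank_zero_of_subsingleton

end Readings

/-! ## §4 CRK from three corank values -/

section CRK

variable {K : Type u} [Field K] [NumberField K] {S : Set (HeightOneSpectrum (𝓞 K))}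
  {Λ : Type u} [CommRing Λ] [TopologicalSpace Λ]
  {D : Type u} [AddCommGroup D] [Module Λ D] [TopologicalSpace D] [DiscreteTopology D]
  [ContinuousSMul Λ D] {ρ : ContinuousRep (GaloisGroupUnramifiedOutside K S) Λ D}

/-- **CRK(`𝐃`, `𝓛`) from three corank VALUES**: if `corank H¹(K_Σ/K, 𝐃) = s₀ + q₀`,
`corank S_𝓛(K, 𝐃) = s₀` and `corank Q_𝓛(K, 𝐃) = q₀`, then CRK holds (coranks are unique).
In the cell's instance `s₀ = 0` (Rubin/BCGKPST: the Selmer group is cotorsion, via K-Sh) and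
`q₀ = 1 = corank H¹` (`hasCorank_H1_one_of_prop41`; `q₀`: the `𝔭̄`-factor, MEMO-8 §3).
[cite: Greenberg2016Selmer, §2.3 p. 7 L7–17 (CRK)] -/
theorem CRK_of_hasCorank (L : Specification S ρ) {s₀ q₀ : ℕ}
    (hH : HasCorank Λ (ρ.H 1) (s₀ + q₀)) (hSel : HasCorank Λ L.selmer s₀)
    (hQ : HasCorank Λ L.QGlobal q₀) : L.CRK := fun h s q hh hs hq ↦ by
  rw [hasCorank_unique hh hH, hasCorank_unique hs hSel, hasCorank_unique hq hQ]

end CRK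




end Summit.BirchSwinnertonDyer.BirchSwinnertonDyer.Theorems.GreenbergFullAtSelmer

end
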